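/-
Copyright (c) 2026 the pub-hodgecm-mathlib formalisation cell (harness21).  R90-TF SLAB, section S10 (Rogawski 1990, Ch. 13.8), prover R90-C138-p01 (g0):
PAYER of the (U3-ξ) socket `sock_S10_auxGlobaliseTorus : AuxGlobaliseTorusLetter` of FILE U (`Cruxes/H413/Lines/R90_S10_LocalGlobaliseU.lean`);
h413 = `stmt-HodgeConjecture-24833`, route `HCCMUnconditional`.
-/
import Literature.NumberTheory.Automorphic.ConjugateSymplecticLocalComponentSurjective
import Literature.NumberTheory.Automorphic.UnitaryGroupLocalFactors
import Literature.NumberTheory.Rogawski1990.OneDimAutRepHArchType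
import Summits.HodgeConjecture.HodgeConjecture.Theorems.F0P2oStubDictTorusChar
import HarnessLib

/-!
# R90-TF ∕ S10 — GLOBALISATION OF THE TORUS CHARACTERS `η_v, ψ_v` OF `ξ` (the body of `AuxGlobaliseTorusLetter`, socket (U3-ξ) of FILE U)

Cell hodgecm-mathlib, slab R90-TF, section S10 = [Rogawski1990] §13.8 (Props 13.8.1–13.8.3 read at `v`), crux item h413 =
`stmt-HodgeConjecture-24833`; kernel lane `--kind proof --supports stmt-HodgeConjecture-24833 --as helper`; THEOREMS ONLY (no `def`,
no instance, no notation, no named fact, no `sorry`); LAW L9 «DEFS DOWN»: no `Cruxes/…/Lines` import — the socket's statement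
(`R90.S10.AuxGlobaliseTorusLetter`, `Theorems/R90S10LocalGlobaliseUDefs.lean` :109–:127) is proved here TOKEN FOR TOKEN as
`auxGlobaliseTorus` (with `Pl L` spelled `HeightOneSpectrum (𝓞 L⁺)`, its `abbrev` body); the one-line head
`auxGlobaliseTorusLetter_holds : AuxGlobaliseTorusLetter` follows the ★ of the UDefs file.

THE STATEMENT (print [Rogawski1990, §13.8 p. 217 l. 9–12] «every character of `Π′𝒪_v^1` extends to a character of `E^1\E^1_𝔸` …
`φ_w = φ′`»).  `L, L′` CM fields, `v, v′` finite places of `L⁺, L′⁺`, `Φ : L ⊗ L⁺_v ≃+* L′ ⊗ L′⁺_{v′}` a bi-continuous ring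
isomorphism intertwining the conjugations `c ⊗ 1`, `c′ ⊗ 1` (S3's local-transport datum), `v′` NON-SPLIT in `L′`.  Then for every
one-dimensional automorphic `ξ = (η, ψ)` of `H(𝔸_{L⁺})` (★ `OneDimAutRepH L`) there is a one-dimensional automorphic `ξ′ = (η′, ψ′)` of
`H′(𝔸_{L′⁺})` whose local components at `v′` (★ `torusLocalComponent`), read through `Units.map Φ` on the local norm-one torus
`T(L⁺_v) = normOneUnits (c ⊗ 1)`, are `η_v` and `ψ_v`.

THE PROOF (all inputs ★, by name; no Pontryagin duality).
* §1 `exists_heckeCharacter_baseChange_eq_one_semilocalComponent_eq` — at a non-split `v`, a continuous character `θ` of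
  `(L ⊗ L⁺_v)ˣ` killing the `(c ⊗ 1)`-fixed units is the `v`-component (★ `HeckeCharacter.semilocalComponent`) of a Hecke character
  `χ` of `L` trivial on `𝕀_{L⁺}`: pick a conjugate-symplectic `ψ₀` (★ `exists_isConjugateSymplectic_hasInfinityType`); `θ · ψ̃₀,v` is an
  `ω`-type character (★ `IsQuadraticCharExtension`, ★ `isQuadraticCharExtension_semilocalComponent_of_baseChange_eq`), hence the
  `v`-component of a conjugate-symplectic `μ` (★ `exists_isConjugateSymplectic_semilocalComponent_eq` = [ClozelHarrisTaylor2008,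
  Lem. 4.1.1] packaged); `χ := μ̃ · ψ̃₀⁻¹`.
* §2 `exists_isAutomorphic_torusLocalComponent_eq` — at a non-split `v`, every continuous character `χ_T` of `T(L⁺_v)` is the local
  component of an AUTOMORPHIC character of `T(𝔸_{L⁺})` (★ `TorusDict.IsAutomorphic`): apply §1 to `θ(u) := χ_T(u/ū)⁻¹`, pass to the
  torus by the Hilbert-90 dictionary ★ `TorusDict.exists_pullback_eq`, and read the local component through ★
  `cm_pullback_semilocalComponent` (`χ̃_v(u) = η_v(u/ū)⁻¹`) and local Hilbert 90 at the non-split place ★ `exists_quotConj_eq_of_nonsplit`.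
* §3 `auxGlobaliseTorus` — transport `η_v`, `ψ_v` along `Φ⁻¹` to characters of `T′(L′⁺_{v′})` (`Φ` intertwines the conjugations),
  globalise both by §2, and assemble `ξ′` by ★ `OneDimAutRepH.ofAutomorphic` (the archimedean-type fields are automatic, ★
  `OneDimAutRepHArchType`).

HONEST LABEL: a helper ★ pays no socket until the Lines edition names it; HC_CM is proved only modulo the 7 printed citations
(2 remaining named inputs: hLiu418 = `stmt-HodgeConjecture-24832`, h413 = `stmt-HodgeConjecture-24833`) until rung 0 closes; REL ≠ ★ ≠ BUILT.

## References
* [Rogawski1990] J. Rogawski, *Automorphic Representations of Unitary Groups in Three Variables*, Ann. of Math. Stud. 123 (1990), §13.8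
  p. 217 l. 9–12, §12.1 p. 172, §12.2 pp. 173–174.
* [ClozelHarrisTaylor2008] L. Clozel, M. Harris, R. Taylor, Publ. Math. IHÉS 108 (2008), Lemma 4.1.1 (p. 116).
* [CasselsFrohlichANT1967] J. W. S. Cassels, A. Fröhlich (eds.), *Algebraic Number Theory* (1967), Ch. V §2.7 (Hilbert 90), Ch. VII §7.4.
-/

set_option autoImplicit false
set_option linter.dupNamespace false

noncomputable section

open NumberField IsDedekindDomain
open Literature.NumberTheory.Rogawski1990 Literature.NumberTheory.Automorphic Literature.NumberTheory.Automorphic.UnitaryGroup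
open Literature.NumberTheory.Automorphic.IdeleClassGroup
open Literature.NumberTheory.GaloisRepresentations
open Literature.NumberTheory.Automorphic.Arthur2013.Leaves.TECR
open Literature.RepresentationTheory.Liu2021 (isOscillatorChar_toHeckeCharacter_iff)
open Literature.NumberTheory.ComplexMultiplication (CMTypeCount.nonempty_cmType_iff_isTotallyComplex)
open Summit.HodgeConjecture.HodgeConjecture.Cruxes.H413.F0P2oStubDictTorusChar (exists_quotConj_eq_of_nonsplit)

namespace Summit.HodgeConjecture.HodgeConjecture.R90.S10

section OneField

variable (L : Type) [Field L] [NumberField L] [IsCMField L]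

/-! ## §1 Hecke characters trivial on `𝕀_{L⁺}` with a prescribed component at a non-split place -/

/-- **A local character killing `L⁺_vˣ` is the `v`-component of a Hecke character trivial on `𝕀_{L⁺}`.**  `L` CM, `v` a finite
place of `L⁺` NOT split in `L`, `θ : (L ⊗ L⁺_v)ˣ → ℂˣ` continuous and trivial on the `(c ⊗ 1)`-fixed units.  Then
`θ = χ_v` (★ `HeckeCharacter.semilocalComponent`) for a Hecke character `χ` of `L` with `χ|_{𝕀_{L⁺}} = 1`.  Proof: for a
conjugate-symplectic `ψ₀` (★ `exists_isConjugateSymplectic_hasInfinityType`) the product `θ · ψ̃₀,v` is an `ω`-type character, hence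
`= μ̃_v` for a conjugate-symplectic `μ` (★ `exists_isConjugateSymplectic_semilocalComponent_eq`); take `χ := μ̃ · ψ̃₀⁻¹`.
[cite: Rogawski1990, §13.8 p. 217 l. 9–12] [cite: ClozelHarrisTaylor2008, Lemma 4.1.1 (p. 116)] -/
theorem exists_heckeCharacter_baseChange_eq_one_semilocalComponent_eq
    (v : HeightOneSpectrum (𝓞 ↥(maximalRealSubfield L)))
    (hns : ∀ w : UnitaryGroup.PlacesOver L v, IsCMField.complexConj L • w.1 = w.1)
    (θ : (UnitaryGroup.LocalRing L v)ˣ →* ℂˣ) (hθc : Continuous fun x => ((θ x : ℂˣ) : ℂ))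
    (hθfix : ∀ x : (UnitaryGroup.LocalRing L v)ˣ,
      conjLocal L (IsCMField.complexConj L) v (x : UnitaryGroup.LocalRing L v) = x → θ x = 1) :
    ∃ χ : HeckeCharacter L,
      (∀ a : ideleGroup ↥(maximalRealSubfield L), χ (AdeleRing.ideleBaseChange (↥(maximalRealSubfield L)) L a) = 1) ∧
        χ.semilocalComponent L v = θ := by
  classical
  obtain ⟨Φ⟩ := (CMTypeCount.nonempty_cmType_iff_isTotallyComplex (K := L)).2 inferInstance
  obtain ⟨ψ₀, hψ₀, -⟩ := exists_isConjugateSymplectic_hasInfinityType Φ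
  -- the base change of a conjugate-symplectic character restricted to `𝕀_{L⁺}` is `ε_{L/L⁺}`
  have hbc : ∀ ψ : IdeleClassGroup L →ₜ* Circle, IsConjugateSymplectic L ψ →
      ∀ x : ideleGroup ↥(maximalRealSubfield L),
        toHeckeCharacter L ψ (AdeleRing.ideleBaseChange (↥(maximalRealSubfield L)) L x) = quadraticHeckeCharCM L x := by
    intro ψ hψ x
    have h := (isOscillatorChar_toHeckeCharacter_iff ψ).2 hψ x
    rw [pow_one] at h
    exact h
  have hq₀ : IsQuadraticCharExtension (conjLocal L (IsCMField.complexConj L) v)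
      ((toHeckeCharacter L ψ₀).semilocalComponent L v) :=
    isQuadraticCharExtension_semilocalComponent_of_baseChange_eq (toHeckeCharacter L ψ₀) (hbc ψ₀ hψ₀) v
  -- `θ · ψ̃₀,v` is an `ω`-type character
  have hμ' : IsQuadraticCharExtension (conjLocal L (IsCMField.complexConj L) v)
      (θ * (toHeckeCharacter L ψ₀).semilocalComponent L v) := by
    intro x hx
    rw [MonoidHom.mul_apply, hθfix x hx, one_mul]
    exact hq₀ x hx
  have hμ'c : Continuous fun x => (((θ * (toHeckeCharacter L ψ₀).semilocalComponent L v) x : ℂˣ) : ℂ) := by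
    simp only [MonoidHom.mul_apply, Units.val_mul]
    exact hθc.mul (Units.continuous_val.comp (continuous_semilocalComponent L (toHeckeCharacter L ψ₀)))
  obtain ⟨μ, hμ, hμv⟩ := exists_isConjugateSymplectic_semilocalComponent_eq L v hns _ hμ' hμ'c
  refine ⟨toHeckeCharacter L μ * (toHeckeCharacter L ψ₀)⁻¹, fun a => ?_, MonoidHom.ext fun x => ?_⟩
  · rw [HeckeCharacter.mul_apply, HeckeCharacter.inv_apply, hbc μ hμ, hbc ψ₀ hψ₀, mul_inv_cancel]
  · rw [semilocalComponent_apply, HeckeCharacter.mul_apply, HeckeCharacter.inv_apply, ← semilocalComponent_apply,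
      ← semilocalComponent_apply, hμv, MonoidHom.mul_apply, mul_inv_cancel_right]

/-! ## §2 Automorphic characters of `T(𝔸_{L⁺})` with a prescribed component at a non-split place -/

/-- **Every continuous character of the local torus `T(L⁺_v)` at a NON-SPLIT `v` is the `v`-component of an automorphic character
of `T(𝔸_{L⁺})`** («every character of `Π′𝒪_v^1` extends to a character of `E^1\E^1_𝔸`»): for `χ_T : T(L⁺_v) → ℂˣ` continuous there
is `η : T(𝔸_{L⁺}) →ₜ* ℂˣ` automorphic (★ `TorusDict.IsAutomorphic`) with `η_v = χ_T` (★ `torusLocalComponent`).  Proof: §1 at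
`θ(u) := χ_T(u/ū)⁻¹`, the Hilbert-90 dictionary ★ `TorusDict.exists_pullback_eq`, the local dictionary ★ `cm_pullback_semilocalComponent`
and local Hilbert 90 ★ `exists_quotConj_eq_of_nonsplit`. [cite: Rogawski1990, §13.8 p. 217 l. 9–12; §12.1 p. 172]
[cite: CasselsFrohlichANT1967, Ch. V §2.7; Ch. VII §7.4] -/
theorem exists_isAutomorphic_torusLocalComponent_eq
    (v : HeightOneSpectrum (𝓞 ↥(maximalRealSubfield L)))
    (hns : ∀ w : UnitaryGroup.PlacesOver L v, IsCMField.complexConj L • w.1 = w.1)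
    (χT : ↥(normOneUnits (conjLocal L (IsCMField.complexConj L) v)) →* ℂˣ)
    (hχTc : Continuous fun t => ((χT t : ℂˣ) : ℂ)) :
    ∃ (η : ↥(TorusDict.torus (IsCMField.complexConj L)) →ₜ* ℂˣ) (_ : TorusDict.IsAutomorphic (IsCMField.complexConj L) η),
      torusLocalComponent L (IsCMField.complexConj L) v η = χT := by
  -- `q u = u / ū ∈ T(L⁺_v)`
  let q : (UnitaryGroup.LocalRing L v)ˣ →* ↥(normOneUnits (conjLocal L (IsCMField.complexConj L) v)) :=
    quotConj (conjLocal L (IsCMField.complexConj L) v) (conjLocal_conjLocal_cm L v)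
  have hqc : Continuous q := by
    have hmap : Continuous (Units.map (conjLocal L (IsCMField.complexConj L) v :
        UnitaryGroup.LocalRing L v →* UnitaryGroup.LocalRing L v)) :=
      Continuous.units_map _ (continuous_conjLocal L (IsCMField.complexConj L) v)
    show Continuous (quotConj (conjLocal L (IsCMField.complexConj L) v) (conjLocal_conjLocal_cm L v))
    refine Continuous.subtype_mk ?_ _
    exact continuous_id.mul hmap.inv
  -- `θ u := χ_T (u / ū)⁻¹`
  let θ : (UnitaryGroup.LocalRing L v)ˣ →* ℂˣ := (χT.comp q)⁻¹
  have hθ_apply : ∀ u, θ u = (χT (q u))⁻¹ := fun _ => rfl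
  have hθc : Continuous fun x => ((θ x : ℂˣ) : ℂ) := by
    have h : (fun x => ((θ x : ℂˣ) : ℂ)) = fun x => ((χT (q x⁻¹) : ℂˣ) : ℂ) :=
      funext fun x => by rw [hθ_apply, ← map_inv, ← map_inv]
    rw [h]
    exact hχTc.comp (hqc.comp continuous_inv)
  have hθfix : ∀ x : (UnitaryGroup.LocalRing L v)ˣ,
      conjLocal L (IsCMField.complexConj L) v (x : UnitaryGroup.LocalRing L v) = x → θ x = 1 := by
    intro x hx
    have hq1 : q x = 1 := by
      apply Subtype.ext
      have hmx : Units.map (conjLocal L (IsCMField.complexConj L) v :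
          UnitaryGroup.LocalRing L v →* UnitaryGroup.LocalRing L v) x = x := Units.ext hx
      show ((quotConj (conjLocal L (IsCMField.complexConj L) v) (conjLocal_conjLocal_cm L v) x :
          ↥(normOneUnits (conjLocal L (IsCMField.complexConj L) v))) : (UnitaryGroup.LocalRing L v)ˣ) = 1
      rw [coe_quotConj, hmx, mul_inv_cancel]
    rw [hθ_apply, hq1, map_one, inv_one]
  obtain ⟨χ, hχbc, hχv⟩ := exists_heckeCharacter_baseChange_eq_one_semilocalComponent_eq L v hns θ hθc hθfix
  obtain ⟨η, hη, hpull⟩ := TorusDict.exists_pullback_eq (IsCMField.complexConj L)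
    (Algebra.IsQuadraticExtension.finrank_eq_two _ L) (IsCMField.complexConj_ne_one (K := L)) χ hχbc
  refine ⟨η, hη, MonoidHom.ext fun β => ?_⟩
  obtain ⟨x, rfl⟩ := exists_quotConj_eq_of_nonsplit L v hns β
  have h1 := cm_pullback_semilocalComponent L η hη x
  rw [hpull, hχv, hθ_apply] at h1
  exact (inv_injective h1).symm

end OneField

/-! ## §3 The socket body: transport along `Φ` and globalise -/

/-- **(U3-ξ) GLOBALISATION OF THE TORUS CHARACTERS `η_v, ψ_v` OF `ξ` — the body of `R90.S10.AuxGlobaliseTorusLetter`, TOKEN FOR TOKEN**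
(`Pl L` spelled by its `abbrev` body).  Along S3's local-transport datum `(Φ, hc, hc′, hΦσ)` towards a NON-SPLIT `v′`, the local components
`η_v, ψ_v` of the automorphic torus characters of `ξ = (η, ψ)` (★ `OneDimAutRepH L`) are the `v′`-components, read through `Units.map Φ`
on `T(L⁺_v) = normOneUnits (c ⊗ 1)`, of SOME one-dimensional automorphic `ξ′ = (η′, ψ′)` of `H′(𝔸_{L′⁺})`.  Proof: pull `η_v`, `ψ_v` back
along `Φ⁻¹` (which maps `T′(L′⁺_{v′})` into `T(L⁺_v)` because `Φ` intertwines the conjugations), globalise each by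
`exists_isAutomorphic_torusLocalComponent_eq`, and assemble `ξ′` with ★ `OneDimAutRepH.ofAutomorphic` (archimedean types automatic).
«every character of `Π′𝒪_v^1` extends to a character of `E^1\E^1_𝔸` … `φ_w = φ′`». [cite: Rogawski1990, §13.8 p. 217 l. 9–12] -/
theorem auxGlobaliseTorus :
    ∀ (L : Type) [Field L] [NumberField L] [IsCMField L] (ξ : OneDimAutRepH L)
      (v : HeightOneSpectrum (𝓞 ↥(maximalRealSubfield L)))
      (L' : Type) [Field L'] [NumberField L'] [IsCMField L'] (v' : HeightOneSpectrum (𝓞 ↥(maximalRealSubfield L')))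
      (Φ : UnitaryGroup.LocalRing L v ≃+* UnitaryGroup.LocalRing L' v'), Continuous Φ → Continuous Φ.symm →
      (∀ x, Φ ((conjLocal L (IsCMField.complexConj L) v) x) = (conjLocal L' (IsCMField.complexConj L') v') (Φ x)) →
      (∀ w' : UnitaryGroup.PlacesOver L' v', IsCMField.complexConj L' • w'.1 = w'.1) →
      ∃ ξ' : OneDimAutRepH L',
        (∀ (t : ↥(normOneUnits (conjLocal L (IsCMField.complexConj L) v)))
          (ht : Units.map (Φ : UnitaryGroup.LocalRing L v →+* UnitaryGroup.LocalRing L' v').toMonoidHom t.1 ∈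
            normOneUnits (conjLocal L' (IsCMField.complexConj L') v')),
          torusLocalComponent L' (IsCMField.complexConj L') v' ξ'.η
              ⟨Units.map (Φ : UnitaryGroup.LocalRing L v →+* UnitaryGroup.LocalRing L' v').toMonoidHom t.1, ht⟩ =
            torusLocalComponent L (IsCMField.complexConj L) v ξ.η t) ∧
        (∀ (t : ↥(normOneUnits (conjLocal L (IsCMField.complexConj L) v)))
          (ht : Units.map (Φ : UnitaryGroup.LocalRing L v →+* UnitaryGroup.LocalRing L' v').toMonoidHom t.1 ∈
            normOneUnits (conjLocal L' (IsCMField.complexConj L') v')),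
          torusLocalComponent L' (IsCMField.complexConj L') v' ξ'.ψ
              ⟨Units.map (Φ : UnitaryGroup.LocalRing L v →+* UnitaryGroup.LocalRing L' v').toMonoidHom t.1, ht⟩ =
            torusLocalComponent L (IsCMField.complexConj L) v ξ.ψ t) := by
  intro L _ _ _ ξ v L' _ _ _ v' Φ hc hc' hΦσ hns'
  -- ONE character at a time: transport `χ_v` along `Φ⁻¹` and globalise on `L′`
  have key : ∀ χ : ↥(TorusDict.torus (IsCMField.complexConj L)) →ₜ* ℂˣ,
      ∃ (η' : ↥(TorusDict.torus (IsCMField.complexConj L')) →ₜ* ℂˣ)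
        (_ : TorusDict.IsAutomorphic (IsCMField.complexConj L') η'),
        ∀ (t : ↥(normOneUnits (conjLocal L (IsCMField.complexConj L) v)))
          (ht : Units.map (Φ : UnitaryGroup.LocalRing L v →+* UnitaryGroup.LocalRing L' v').toMonoidHom t.1 ∈
            normOneUnits (conjLocal L' (IsCMField.complexConj L') v')),
          torusLocalComponent L' (IsCMField.complexConj L') v' η'
              ⟨Units.map (Φ : UnitaryGroup.LocalRing L v →+* UnitaryGroup.LocalRing L' v').toMonoidHom t.1, ht⟩ =
            torusLocalComponent L (IsCMField.complexConj L) v χ t := by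
    intro χ
    -- `Φ⁻¹` intertwines the conjugations
    have hΦσ' : ∀ y, Φ.symm ((conjLocal L' (IsCMField.complexConj L') v') y) =
        (conjLocal L (IsCMField.complexConj L) v) (Φ.symm y) := fun y =>
      Φ.injective (by rw [Φ.apply_symm_apply, hΦσ, Φ.apply_symm_apply])
    -- hence maps `T′(L′⁺_{v′})` into `T(L⁺_v)`
    have hmem : ∀ t' : ↥(normOneUnits (conjLocal L' (IsCMField.complexConj L') v')),
        Units.map (Φ.symm : UnitaryGroup.LocalRing L' v' →+* UnitaryGroup.LocalRing L v).toMonoidHom t'.1 ∈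
          normOneUnits (conjLocal L (IsCMField.complexConj L) v) := by
      intro t'
      have h := (mem_normOneUnits_iff (t'.1)).1 t'.2
      rw [mem_normOneUnits_iff]
      change (conjLocal L (IsCMField.complexConj L) v) (Φ.symm (t'.1 : UnitaryGroup.LocalRing L' v')) *
          Φ.symm (t'.1 : UnitaryGroup.LocalRing L' v') = 1
      rw [← hΦσ', ← map_mul, h, map_one]
    let ι : ↥(normOneUnits (conjLocal L' (IsCMField.complexConj L') v')) →*
        ↥(normOneUnits (conjLocal L (IsCMField.complexConj L) v)) :=
      ((Units.map (Φ.symm : UnitaryGroup.LocalRing L' v' →+* UnitaryGroup.LocalRing L v).toMonoidHom).comp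
        (normOneUnits (conjLocal L' (IsCMField.complexConj L') v')).subtype).codRestrict _ hmem
    have hιc : Continuous ι := by
      refine Continuous.subtype_mk ?_ _
      have hu : Continuous (Units.map (Φ.symm : UnitaryGroup.LocalRing L' v' →+* UnitaryGroup.LocalRing L v).toMonoidHom) :=
        Continuous.units_map _ hc'
      exact hu.comp continuous_subtype_val
    -- the transported local character and its globalisation
    let χT : ↥(normOneUnits (conjLocal L' (IsCMField.complexConj L') v')) →* ℂˣ :=
      (torusLocalComponent L (IsCMField.complexConj L) v χ).comp ι
    have hχTc : Continuous fun t' => ((χT t' : ℂˣ) : ℂ) :=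
      (continuous_torusLocalComponent L (IsCMField.complexConj L) χ).comp hιc
    obtain ⟨η', hη', hloc⟩ := exists_isAutomorphic_torusLocalComponent_eq L' v' hns' χT hχTc
    refine ⟨η', hη', fun t ht => ?_⟩
    have hιt : ι ⟨Units.map (Φ : UnitaryGroup.LocalRing L v →+* UnitaryGroup.LocalRing L' v').toMonoidHom t.1, ht⟩ = t :=
      Subtype.ext (Units.ext (Φ.symm_apply_apply _))
    rw [hloc]
    show torusLocalComponent L (IsCMField.complexConj L) v χ
        (ι ⟨Units.map (Φ : UnitaryGroup.LocalRing L v →+* UnitaryGroup.LocalRing L' v').toMonoidHom t.1, ht⟩) = _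
    rw [hιt]
  obtain ⟨η', hη', hη'loc⟩ := key ξ.η
  obtain ⟨ψ', hψ', hψ'loc⟩ := key ξ.ψ
  exact ⟨OneDimAutRepH.ofAutomorphic η' ψ' hη' hψ', hη'loc, hψ'loc⟩

end Summit.HodgeConjecture.HodgeConjecture.R90.S10

end
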